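import Summits.RiemannHypothesis.RiemannHypothesis.Theorems.Splittings.NbCoefficientMass
import Summits.RiemannHypothesis.RiemannHypothesis.Theorems.Splittings.NbLevelCertificate
import HarnessLib

/-!
# RH-EQUIVALENT·SPLITTING CENSUS (nb, neg) · V34 «MASS», part 2: every bounded-mass — indeed every polynomial-mass — Nyman–Beurling conjunct is REFUTED unconditionally; nothing here bears on the truth of RH

LABEL (line 1): RH-EQUIVALENT·SPLITTING (cell `rh-split`, seat (nb, neg), generation 9, census
candidate V34, part 2 of 2; part 1 = `Splittings.NbCoefficientMass`, the mass law). UNCONDITIONAL: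
the only input beyond real analysis is ONE critical-line zero of `ζ` (Hardy 1914, the tree's theorem
`BaezDuarteU.exists_zeta_zero_half`). NOTHING HERE BEARS ON THE TRUTH OF RH.

## Results (namespace `…Splittings.NbCoefficientMass`, continued)

* `nbDist_pos` — every NB approximant (`a_j ≥ 1`) is at positive `L²(0,∞)` distance from `χ`
  (read off the tree's BDBLS/Burnol bound `BaezDuarteU.lowerBound_real` with `N = 2 + Σ a_j`).
* `exp_le_of_nbDist_lt_half`, `le_nbDist_of_coeffMass_le` — the law at small distance and the
  explicit radius `nbDist ≥ min(1/2, 1/(256|ρ|³(1+|B|)+1))` for coefficient mass `≤ B`.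
* `not_nbBddMassApprox`, `not_exists_bddMass_nbApprox` — **V34 refuted**: for no `B` do NB
  approximants of coefficient mass `≤ B` come arbitrarily close to `χ` (so the would-be splitting
  `MASS(B) ∧ ⊤ ⟹ RH` is idle).
* `not_nbPolyMassApprox` — the natural repair «mass ≤ (1/ε)^k» is refuted for every `k` as well
  (`exp` beats powers: `Real.pow_div_factorial_le_exp`); the first unrefuted budget is `exp(C/ε²)`.
* `nbDist_bdDil`, `massLaw_nat`, `not_nbBddMassApprox_nat` — the same read on the cell's certified
  object `d_N² = nbDistSq N c` (natural dilations `k+1`) through the tree dictionary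
  `NbLevelCertificate.integral_norm_sq_nbFun_eq_nbDistSq`.
-/

noncomputable section

set_option linter.dupNamespace false

open Complex MeasureTheory Set Filter
open scoped Real

namespace Summit.RiemannHypothesis.RiemannHypothesis.Theorems.Splittings.NbCoefficientMass

open Literature.NumberTheory.LFunctions Literature.NumberTheory.LFunctions.BaezDuarteU
open Summit.RiemannHypothesis.RiemannHypothesis.Theorems.NbTheory (nbDistSq)

variable {n : ℕ} (a c : Fin n → ℝ)

/-! ## 3. V34 refuted: no bounded-mass (indeed no polynomial-mass) Nyman–Beurling approximation -/

/-- The distance of ANY NB approximant (real dilations `≥ 1`) to `χ` is positive — a corollary of the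
tree's BDBLS/Burnol lower bound `BaezDuarteU.lowerBound_real` with `N = 2 + Σ_j a_j`. -/
theorem nbDist_pos (ha : ∀ j, 1 ≤ a j) : 0 < nbDist a c := by
  obtain ⟨C, hC, hlow⟩ := lowerBound_real
  set N : ℝ := 2 + ∑ j, a j with hN
  have hsum : ∀ j, a j ≤ ∑ i, a i := fun j ↦
    Finset.single_le_sum (f := a) (fun i _ ↦ by linarith [ha i]) (Finset.mem_univ j)
  have haN : ∀ j, 1 ≤ a j ∧ a j ≤ N := fun j ↦ ⟨ha j, by rw [hN]; linarith [hsum j]⟩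
  have hN2 : 2 ≤ N := by
    rw [hN]; linarith [Finset.sum_nonneg (f := a) (s := Finset.univ) fun i _ ↦ by linarith [ha i]]
  have h := hlow n a c N haN hN2
  have hpos : 0 < C / Real.sqrt (Real.log N) :=
    div_pos hC (Real.sqrt_pos.2 (Real.log_pos (by linarith)))
  exact lt_of_lt_of_le hpos h

/-- The mass law at small distance: if `ζ(1/2+iγ) = 0`, `r = |1/2+iγ|`, `a_j ≥ 1` and `d = nbDist a c < 1/2`,
then `(1/(8r)) · exp(1/(32 r² d²)) ≤ 1 + Σ_j |c_j|`. -/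
theorem exp_le_of_nbDist_lt_half (ha : ∀ j, 1 ≤ a j) {γ : ℝ} (hγ : riemannZeta (1 / 2 + γ * I) = 0)
    (hd : nbDist a c < 1 / 2) :
    1 / (8 * ‖(1 / 2 + γ * I : ℂ)‖) *
        Real.exp (1 / (32 * ‖(1 / 2 + γ * I : ℂ)‖ ^ 2 * nbDist a c ^ 2)) ≤ 1 + coeffMass c := by
  set r : ℝ := ‖(1 / 2 + γ * I : ℂ)‖ with hr
  have hrpos : 0 < r := by
    rw [hr, norm_pos_iff]
    intro h
    have := congrArg Complex.re h
    simp at this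
  set d : ℝ := nbDist a c with hdd
  have hdpos : 0 < d := nbDist_pos a c ha
  have hlaw := massLaw a c ha hγ
  rw [← hr, ← hdd] at hlaw
  set E : ℝ := (1 - d) ^ 2 / (8 * r ^ 2 * d ^ 2) with hE
  have hE0 : 1 / (32 * r ^ 2 * d ^ 2) ≤ E := by
    rw [hE, show 1 / (32 * r ^ 2 * d ^ 2) = (1 / 4) / (8 * r ^ 2 * d ^ 2) by
      field_simp; ring]
    gcongr
    nlinarith
  have hfac : 1 / (8 * r) ≤ (1 - d) / (4 * r) := by
    rw [div_le_div_iff₀ (by positivity) (by positivity)]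
    nlinarith
  calc 1 / (8 * r) * Real.exp (1 / (32 * r ^ 2 * d ^ 2))
      ≤ 1 / (8 * r) * Real.exp E := by gcongr
    _ ≤ (1 - d) / (4 * r) * Real.exp E := mul_le_mul_of_nonneg_right hfac (Real.exp_pos _).le
    _ ≤ 1 + coeffMass c := hlaw

/-- **Explicit radius**: if `ζ(1/2+iγ) = 0`, `r = |1/2+iγ|`, then every NB approximant with `a_j ≥ 1`
and coefficient mass `≤ B` stays at distance `≥ min(1/2, 1/(256 r³ (1+|B|) + 1))` from `χ`
(crude but explicit; from the mass law and `exp x ≥ 1 + x`). -/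
theorem le_nbDist_of_coeffMass_le (ha : ∀ j, 1 ≤ a j) {γ : ℝ} (hγ : riemannZeta (1 / 2 + γ * I) = 0)
    {B : ℝ} (hB : coeffMass c ≤ B) :
    min (1 / 2) (1 / (256 * ‖(1 / 2 + γ * I : ℂ)‖ ^ 3 * (1 + |B|) + 1)) ≤ nbDist a c := by
  set r : ℝ := ‖(1 / 2 + γ * I : ℂ)‖ with hr
  have hrpos : 0 < r := by
    rw [hr, norm_pos_iff]
    intro h
    have := congrArg Complex.re h
    simp at this
  set d : ℝ := nbDist a c with hd
  have hdpos : 0 < d := nbDist_pos a c ha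
  by_contra hlt
  push Not at hlt
  have hdhalf : d < 1 / 2 := lt_of_lt_of_le hlt (min_le_left _ _)
  have hdε : d < 1 / (256 * r ^ 3 * (1 + |B|) + 1) := lt_of_lt_of_le hlt (min_le_right _ _)
  have hlaw := exp_le_of_nbDist_lt_half a c ha hγ hdhalf
  rw [← hr, ← hd] at hlaw
  have hexp : 1 / (32 * r ^ 2 * d ^ 2) ≤ Real.exp (1 / (32 * r ^ 2 * d ^ 2)) :=
    le_trans (by linarith) (Real.add_one_le_exp _)
  have hkey : 1 / (256 * r ^ 3 * d ^ 2) ≤ 1 + B :=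
    calc 1 / (256 * r ^ 3 * d ^ 2) = (1 / (8 * r)) * (1 / (32 * r ^ 2 * d ^ 2)) := by
          rw [div_mul_div_comm, one_mul]; congr 1; ring
      _ ≤ (1 / (8 * r)) * Real.exp (1 / (32 * r ^ 2 * d ^ 2)) :=
          mul_le_mul_of_nonneg_left hexp (by positivity)
      _ ≤ 1 + coeffMass c := hlaw
      _ ≤ 1 + B := by linarith
  have hd2 : d ^ 2 < 1 / (256 * r ^ 3 * (1 + |B|) + 1) := by
    have : d ^ 2 ≤ d := by nlinarith
    exact lt_of_le_of_lt this hdε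
  have hbig : 1 + |B| < 1 / (256 * r ^ 3 * d ^ 2) := by
    rw [lt_div_iff₀ (by positivity)]
    have h3 : 256 * r ^ 3 * (1 + |B|) * d ^ 2 < 256 * r ^ 3 * (1 + |B|) *
        (1 / (256 * r ^ 3 * (1 + |B|) + 1)) := mul_lt_mul_of_pos_left hd2 (by positivity)
    have h4 : 256 * r ^ 3 * (1 + |B|) * (1 / (256 * r ^ 3 * (1 + |B|) + 1)) < 1 := by
      rw [mul_one_div, div_lt_one (by positivity)]; linarith
    nlinarith
  linarith [le_abs_self B]

/-- **V34 REFUTED (unconditional).** The census conjunct «MASS(B)» — for every `ε > 0` some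
Nyman–Beurling approximant `Σ_j c_j ρ_{a_j}` (finitely many real dilations `a_j ≥ 1`, real coefficients)
of coefficient mass `Σ|c_j| ≤ B` is within `ε` of `χ` in `L²(0,∞)` — is FALSE for every `B`: one
critical-line zero of `ζ` (Hardy) and the mass law forbid it. (MASS(B) implies the Báez-Duarte/Beurling
criterion, hence RH, so the would-be splitting `MASS(B) ∧ ⊤ ⟹ RH` is idle; nothing here bears on the
truth of RH.) -/
theorem not_nbBddMassApprox (B : ℝ) :
    ¬ ∀ ε : ℝ, 0 < ε → ∃ (n : ℕ) (a c : Fin n → ℝ), (∀ j, 1 ≤ a j) ∧ coeffMass c ≤ B ∧ nbDist a c < ε := by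
  intro h
  obtain ⟨γ, hγ⟩ := exists_zeta_zero_half
  set ε : ℝ := min (1 / 2) (1 / (256 * ‖(1 / 2 + γ * I : ℂ)‖ ^ 3 * (1 + |B|) + 1)) with hε
  have hεpos : 0 < ε := by positivity
  obtain ⟨n, a, c, ha, hB, hd⟩ := h ε hεpos
  exact absurd (le_nbDist_of_coeffMass_le a c ha hγ hB) (not_le.2 hd)

/-- The same in raw form (no auxiliary definitions): there is no `B` such that for every `ε > 0` some
`f = χ − Σ_j c_j ρ_{a_j}` with `a_j ≥ 1`, `Σ|c_j| ≤ B` has `‖f‖_{L²(0,∞)} < ε`. -/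
theorem not_exists_bddMass_nbApprox :
    ¬ ∃ B : ℝ, ∀ ε : ℝ, 0 < ε → ∃ (n : ℕ) (a c : Fin n → ℝ), (∀ j, 1 ≤ a j) ∧
      ∑ j, |c j| ≤ B ∧ Real.sqrt (∫ t in Ioi (0 : ℝ), ‖nbFun a c t‖ ^ 2) < ε := by
  rintro ⟨B, hB⟩
  exact not_nbBddMassApprox B hB

/-- **Repair R4 refuted too — polynomial mass budgets.** For every `k : ℕ` it is FALSE that for every
`ε > 0` some NB approximant (`a_j ≥ 1`) of coefficient mass `≤ (1/ε)^k` is within `ε` of `χ`: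
the law's `exp(1/(32 r² ε²))` beats every power of `1/ε`. (So «mass ≤ poly(1/ε)» is not a repair of
V34; the first unrefuted budget is `exp(C/ε²)`, which is what BDBLS + RH would predict — a costume.) -/
theorem not_nbPolyMassApprox (k : ℕ) :
    ¬ ∀ ε : ℝ, 0 < ε → ∃ (n : ℕ) (a c : Fin n → ℝ), (∀ j, 1 ≤ a j) ∧
      coeffMass c ≤ (1 / ε) ^ k ∧ nbDist a c < ε := by
  intro h
  obtain ⟨γ, hγ⟩ := exists_zeta_zero_half
  set r : ℝ := ‖(1 / 2 + γ * I : ℂ)‖ with hr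
  have hrpos : 0 < r := by
    rw [hr, norm_pos_iff]
    intro h0
    have := congrArg Complex.re h0
    simp at this
  -- the threshold `W = 32 r² · V₀`, `V₀ = 2 (32 r²)^k · (8 r (k+1)!)`
  set V₀ : ℝ := 2 * (32 * r ^ 2) ^ k * (8 * r * ((k + 1).factorial : ℝ)) with hV₀
  have hV₀pos : 0 < V₀ := by positivity
  set W : ℝ := 32 * r ^ 2 * V₀ with hW
  have hWpos : 0 < W := by positivity
  set ε : ℝ := min (1 / 2) (1 / (W + 1)) with hε
  have hεpos : 0 < ε := by positivity
  have hε1 : ε ≤ 1 / 2 := min_le_left _ _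
  obtain ⟨n, a, c, ha, hS, hdε⟩ := h ε hεpos
  set d : ℝ := nbDist a c with hd
  have hdpos : 0 < d := nbDist_pos a c ha
  have hdhalf : d < 1 / 2 := lt_of_lt_of_le hdε hε1
  -- the law at `v = 1/(32 r² d²)`
  set v : ℝ := 1 / (32 * r ^ 2 * d ^ 2) with hv
  have hvpos : 0 < v := by positivity
  have hlaw := exp_le_of_nbDist_lt_half a c ha hγ hdhalf
  rw [← hr, ← hd, ← hv] at hlaw
  -- `1 + S ≤ 2 (1/d²)^k = 2 (32 r²)^k v^k`
  have hinvd : 1 / ε ≤ 1 / d := one_div_le_one_div_of_le hdpos hdε.le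
  have hinvd1 : 1 ≤ 1 / d := by rw [le_div_iff₀ hdpos]; linarith
  have hd2v : 1 / d ^ 2 = 32 * r ^ 2 * v := by rw [hv]; field_simp
  have hS' : coeffMass c ≤ (32 * r ^ 2) ^ k * v ^ k := by
    calc coeffMass c ≤ (1 / ε) ^ k := hS
      _ ≤ (1 / d) ^ k := pow_le_pow_left₀ (by positivity) hinvd k
      _ ≤ (1 / d) ^ (2 * k) := pow_le_pow_right₀ hinvd1 (by omega)
      _ = (1 / d ^ 2) ^ k := by rw [pow_mul, one_div_pow]
      _ = (32 * r ^ 2) ^ k * v ^ k := by rw [hd2v, mul_pow]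
  have hone : 1 ≤ (32 * r ^ 2) ^ k * v ^ k := by
    rw [← mul_pow, ← hd2v]
    exact one_le_pow₀ (by rw [le_div_iff₀ (by positivity)]; nlinarith)
  have hfact := Real.pow_div_factorial_le_exp (x := v) hvpos.le (k + 1)
  -- combine: `(1/(8r)) v^{k+1}/(k+1)! ≤ 2 (32 r²)^k v^k`
  have hchain : 1 / (8 * r) * (v ^ (k + 1) / ((k + 1).factorial : ℝ)) ≤
      2 * ((32 * r ^ 2) ^ k * v ^ k) :=
    calc 1 / (8 * r) * (v ^ (k + 1) / ((k + 1).factorial : ℝ))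
        ≤ 1 / (8 * r) * Real.exp v := mul_le_mul_of_nonneg_left hfact (by positivity)
      _ ≤ 1 + coeffMass c := hlaw
      _ ≤ 2 * ((32 * r ^ 2) ^ k * v ^ k) := by linarith
  have hsep : v / (8 * r * ((k + 1).factorial : ℝ)) * v ^ k ≤ 2 * (32 * r ^ 2) ^ k * v ^ k := by
    have e : 1 / (8 * r) * (v ^ (k + 1) / ((k + 1).factorial : ℝ)) =
        v / (8 * r * ((k + 1).factorial : ℝ)) * v ^ k := by
      rw [pow_succ]; field_simp
    rw [← e]; linarith
  have hvle : v ≤ V₀ := by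
    have h1 : v / (8 * r * ((k + 1).factorial : ℝ)) ≤ 2 * (32 * r ^ 2) ^ k :=
      le_of_mul_le_mul_right hsep (by positivity)
    rw [div_le_iff₀ (by positivity)] at h1
    rw [hV₀]; linarith
  -- hence `d² ≥ 1/W`, contradicting `d < ε ≤ 1/(W+1)`
  have hd2 : 1 / W ≤ d ^ 2 := by
    rw [hW, div_le_iff₀ (by positivity)]
    have : v * (32 * r ^ 2 * d ^ 2) = 1 := by rw [hv]; field_simp
    nlinarith
  have hd2' : d ^ 2 < 1 / (W + 1) := by
    have h5 : d ^ 2 ≤ d := by nlinarith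
    exact lt_of_le_of_lt h5 (lt_of_lt_of_le hdε (min_le_right _ _))
  have : 1 / (W + 1) < 1 / W := one_div_lt_one_div_of_lt hWpos (by linarith)
  linarith

/-! ## 4. The same on the cell's certified object `d_N² = nbDistSq N c` (natural dilations `k+1`) -/

/-- Dictionary: for the natural dilations `a_j = j+1` (`NbLevelCertificate.bdDil`) the distance `nbDist` is
`√(nbDistSq N c)` (the tree's `NbLevelCertificate.integral_norm_sq_nbFun_eq_nbDistSq`). -/
theorem nbDist_bdDil (N : ℕ) (c : Fin N → ℝ) :
    nbDist (NbLevelCertificate.bdDil N) c = Real.sqrt (nbDistSq N c) := by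
  unfold nbDist
  rw [NbLevelCertificate.integral_norm_sq_nbFun_eq_nbDistSq]

/-- **The mass law for natural NB approximants** `χ − Σ_{k<N} c_k ρ_{k+1}`: if `ζ(1/2+iγ) = 0` then
`((1 − d_N(c))/(4|ρ|)) · exp((1 − d_N(c))²/(8|ρ|² d_N(c)²)) ≤ 1 + Σ_k |c_k|`, `d_N(c)² = nbDistSq N c`.
In particular along ANY sequence with `nbDistSq N c⁽ᴺ⁾ → 0` (e.g. the minimisers, iff RH by the tree's
`riemannHypothesis_iff_tendsto_nbDistSq_nbMinimiser`) the coefficient mass is `≥ exp(c/d_N²)`, unbounded. -/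
theorem massLaw_nat (N : ℕ) (c : Fin N → ℝ) {γ : ℝ} (hγ : riemannZeta (1 / 2 + γ * I) = 0) :
    (1 - Real.sqrt (nbDistSq N c)) / (4 * ‖(1 / 2 + γ * I : ℂ)‖) *
        Real.exp ((1 - Real.sqrt (nbDistSq N c)) ^ 2 /
          (8 * ‖(1 / 2 + γ * I : ℂ)‖ ^ 2 * nbDistSq N c)) ≤ 1 + ∑ j, |c j| := by
  have h := massLaw (NbLevelCertificate.bdDil N) c (NbLevelCertificate.one_le_bdDil N) hγ
  have h0 : 0 ≤ nbDistSq N c := ENNReal.toReal_nonneg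
  rw [nbDist_bdDil, Real.sq_sqrt h0] at h
  exact h

/-- **V34 refuted on the natural family**: for no `B` do natural NB approximants `Σ_{k<N} c_k ρ_{k+1}` of
coefficient mass `≤ B` achieve `nbDistSq N c < ε` for every `ε > 0`. -/
theorem not_nbBddMassApprox_nat (B : ℝ) :
    ¬ ∀ ε : ℝ, 0 < ε → ∃ (N : ℕ) (c : Fin N → ℝ), ∑ j, |c j| ≤ B ∧ nbDistSq N c < ε := by
  intro h
  apply not_nbBddMassApprox B
  intro ε hε
  obtain ⟨N, c, hB, hd⟩ := h (ε ^ 2) (by positivity)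
  refine ⟨N, NbLevelCertificate.bdDil N, c, NbLevelCertificate.one_le_bdDil N, hB, ?_⟩
  rw [nbDist_bdDil]
  have h0 : 0 ≤ nbDistSq N c := ENNReal.toReal_nonneg
  calc Real.sqrt (nbDistSq N c) < Real.sqrt (ε ^ 2) := Real.sqrt_lt_sqrt h0 hd
    _ = ε := Real.sqrt_sq hε.le

end Summit.RiemannHypothesis.RiemannHypothesis.Theorems.Splittings.NbCoefficientMass

end
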